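import Summits.HodgeConjecture.HodgeConjecture.Theorems.HeckePrymWeilHeckePrymAnchorsOfStubs
import Summits.HodgeConjecture.HodgeConjecture.Theorems.HeckePrymWeilHeckePrymAnchorsUpgrade
import Summits.HodgeConjecture.HodgeConjecture.Theorems.HeckePrymWeilHeckePrymAnchorsRationalAlongSection
import HarnessLib

/-!
# `HeckePrymAnchors` from a global-class engine and Deligne's Weil family with fibrewise Hodge section (item stmt-HodgeConjecture-14496, route HeckePrymWeil)

Line `Sketch`, skeleton v5 (continuation lead c2): the composition of the crux `HeckePrymAnchors`
from TWO hypotheses, both spelled out (fully hypothetical composition, no named fact imported):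

* `hG` — the W-ENGINE on the open total space: for an embedded smooth projective family
  `f : 𝒳 ⟶ S` over a smooth quasi-projective irreducible base, every continuous section `σ` of the
  espace étalé `FiberClass f k → S(ℂ)` of `Rᵏ f_* ℂ` is the fibrewise restriction of ONE class
  `W ∈ Hᵏ(𝒳(ℂ); ℂ)`. In v4 this was obtained from the partie fixe (Hodge II 4.1.1) through a
  Hironaka compactification of `𝒳`; v5 obtains it (file `…GlobalClassOfLeray`) from the strictly
  weaker input of that theorem's own proof — Deligne 1968 (degeneration of the Leray spectral
  sequence of a projective submersion, Voisin II Thm 4.15/4.18: `Hᵏ(𝒳, ℚ) ↠ Γ(S, Rᵏ f_* ℚ)`) — and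
  the tree's proved identity principle for continuous sections; no compactification, no mixed
  Hodge theory.
* `hWF` — Deligne's polarized `ℚ(√-p)`-Weil family through `X` with its flat Weil section `σ`
  through `c`, a tensor-split fibre, AND clause (a) of the proof of [Deligne1982HodgeCycles,
  Thm. 4.8] (p. 48): every fibre `(Y_s, ν_s)` is of Weil type, so that by [loc. cit., Prop. 4.4] the
  value `σ(s) ∈ ⋀_K^{2k} H¹(Y_s)` is of Hodge type `(k,k)` at EVERY `s` — exactly the input Deligne
  feeds to his Principle B (Thm. 2.12/2.15). With this clause the propagation of Hodge type along
  flat sections (Charles–Schnell Prop. 11.3.5 (1), hypothesis `hCS` of v4) is not needed.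

Everything else is PROVED in the tree and reused from the landed files of the line: the companion
Weil surface (`stub_weilSurface`), the typing upgrade (`stub_upgrade`), rationality along a flat
section (`stub_rationalAlongSection`), the `c = 0` branch (`owf_anchored_zero`), Deligne's
tensor-point anchor across the isogeny pair (`owf_anchorAlgebraic`) and transport along the fibre
isomorphism (`owf_isoTransport`, the route's proved `IsoInvariance`). No definition, no `sorry`.
-/

noncomputable section

-- every declaration of this problem lives in `Summit.HodgeConjecture.HodgeConjecture.…` (summit = sub-problem)
set_option linter.dupNamespace false

open CategoryTheory AlgebraicGeometry Limits MonoidalCategory CartesianMonoidalCategory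

namespace Summit.HodgeConjecture.HodgeConjecture.Theorems.HeckePrymWeilLine

open Literature.AlgebraicGeometry Literature.AlgebraicGeometry.Motives Literature.AlgebraicGeometry.HodgeTheory
open Summit.HodgeConjecture.HodgeConjecture.Theses.HeckePrymWeil

/-- **`HeckePrymAnchors` from the W-engine and the Weil family with fibrewise Hodge section**
(skeleton v5 of line `Sketch`, fully hypothetical). `hG`: every continuous section of
`FiberClass f k → S(ℂ)` of an embedded smooth projective family over a smooth quasi-projective
irreducible base is the global section of one class of the open total space (Deligne 1968 / Voisin
II Thm 4.18 + identity principle; file `…GlobalClassOfLeray`). `hWF`: Deligne's Weil family through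
the `√-p`-abelian `2k`-fold `X` — embedded smooth projective family over a smooth irreducible
quasi-projective base, every fibre a `√-p`-abelian `2k`-fold, `X ≅ 𝒳_{s₁}`, a continuous section
`σ` through `e^{-1 *} c` whose value is of Hodge type `(k,k)` on EVERY fibre (proof of Thm 4.8 (a) +
Prop. 4.4 of LNM 900), and a fibre `Y ≅ 𝒳_{s₀}` with an isogeny pair to a tensor point
`(A₁ × A₁, companion)` at which `σ(s₀)` lies in the strong Weil plane. Proof: `B := E × E` with the
companion `ψ` (`stub_weilSurface`); for a rational `(k,k)` class `c ≠ 0` of the typed Weil plane of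
`(A × B, φ × ψ)` upgrade to the strong plane (`stub_upgrade`), take the family, globalise `σ` to
`W` (`hG`), read rationality of `W|_{𝒳_s}` from `stub_rationalAlongSection` and Hodge type from the
clause of `hWF`, and algebraicity at `s₀` from `owf_anchorAlgebraic` through `owf_isoTransport`;
`c = 0` by the constant family (`owf_anchored_zero`).
[cite: Deligne1982HodgeCycles, proof of Thm. 4.8 (pp. 47–52), Prop. 4.4, Lemma 4.5, Remark 4.10]
[cite: VoisinHodgeII2003, Thm. 4.18] [cite: vanGeemen1994HodgeAV, §5.3–5.11]
[cite: Andre1996Motifs, Lemme 6.3.3] -/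
theorem heckePrymAnchors_of_sections :
    (∀ ⦃𝒳 S : SchemeOver ℂ⦄ (f : 𝒳 ⟶ S) (n k : ℕ), IsSmoothProjectiveFamily f n → (∃ (N : ℕ) (ι : 𝒳 ⟶ projectiveSpace N ℂ ⊗ S), IsClosedImmersion ι.left ∧ ι ≫ snd (projectiveSpace N ℂ) S = f) → AlgebraicGeometry.Smooth S.hom → IsQuasiProjectiveOver S → IrreducibleSpace S.left → ∀ (σ : ComplexPoints S → FiberClass f k), Continuous σ → (∀ s, (σ s).pt = s) → ∃ W : complexBetti 𝒳 k, ∀ s, σ s = globalSection f k W s) → (∀ p : ℕ, p.Prime → p % 4 = 3 → 7 ≤ p → ∀ (k : ℕ), 1 ≤ k → ∀ (X : AbelianVariety ℂ) (Φ : X ⟶ X), X.dim = 2 * k → Φ ≫ Φ = -((p : ℤ) • 𝟙 X) → ∀ c : complexBetti X.X (2 * k), c ∈ weilClassesOf X Φ k p → c ≠ 0 → IsRationalClass c → IsOfHodgeType (2 * k) X.X (2 * k) k k c → ∃ (𝒳 S : SchemeOver ℂ) (f : 𝒳 ⟶ S) (s₁ s₀ : ComplexPoints S) (e : X.X ≅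 fiberOver f s₁) (σ : ComplexPoints S → FiberClass f (2 * k)), IsSmoothProjectiveFamily f (2 * k) ∧ (∃ (N : ℕ) (ι : 𝒳 ⟶ projectiveSpace N ℂ ⊗ S), IsClosedImmersion ι.left ∧ ι ≫ snd (projectiveSpace N ℂ) S = f) ∧ IrreducibleSpace S.left ∧ AlgebraicGeometry.Smooth S.hom ∧ IsQuasiProjectiveOver S ∧ (∀ s : ComplexPoints S, ∃ (A' : AbelianVariety ℂ) (φ' : A' ⟶ A'), A'.dim = 2 * k ∧ φ' ≫ φ' = -((p : ℤ) • 𝟙 A') ∧ Nonempty (A'.X ≅ fiberOver f s)) ∧ Continuous σ ∧ (∀ s, (σ s).pt = s) ∧ (∀ s, IsOfHodgeType (2 * k) (fiberOver f (σ s).pt) (2 * k) k k (σ s).cls) ∧ σ s₁ = ⟨s₁, complexBetti.map e.inv (2 * k) c⟩ ∧ ∃ (Y : AbelianVariety ℂ) (Ψ : Y ⟶ Y) (e₀ : Y.X ≅ fiberOver f s₀) (x : complexBetti (fiberOver f s₀) (2 * k)), (∃ (A₁ : AbelianVariety ℂ) (f₁ : Y ⟶ A₁.prod A₁) (g₁ :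 A₁.prod A₁ ⟶ Y) (m : ℕ), A₁.dim = k ∧ Y.dim = 2 * k ∧ Ψ ≫ Ψ = -((p : ℤ) • 𝟙 Y) ∧ 0 < m ∧ f₁ ≫ g₁ = m • 𝟙 Y ∧ Flat f₁.hom.hom.hom.left ∧ g₁ ≫ Ψ = AbelianVariety.prodLift (AbelianVariety.snd A₁ A₁ ≫ (-((p : ℤ) • 𝟙 A₁))) (AbelianVariety.fst A₁ A₁) ≫ g₁) ∧ σ s₀ = ⟨s₀, x⟩ ∧ complexBetti.map e₀.hom (2 * k) x ∈ weilClassesOf Y Ψ k p) → Summit.HodgeConjecture.HodgeConjecture.Theses.HeckePrymWeil.HeckePrymAnchors := by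
  intro hG hWF p hp hp4 hp7 g hg n k hk hkm A φ hA hφ
  obtain ⟨B, ψ, hBW⟩ := stub_weilSurface p hp hp4 hp7
  refine ⟨B, ψ, hBW.1, hBW.2.1, hBW.2.2, ?_⟩
  intro c hrat hH hW
  have hk1 : 1 ≤ k := by have := owf_three_le_k hp7 hg hkm; omega
  -- the product `X = A × B` with `Φ = φ × ψ`
  have hX : (A.prod B).dim = 2 * k := by
    rw [AbelianVariety.dim_prod, hA, hBW.1]; omega
  have hφ' : φ ≫ φ = -(p • 𝟙 A) := by rw [hφ, natCast_zsmul]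
  have hψ' : ψ ≫ ψ = -(p • 𝟙 B) := by rw [hBW.2.1, natCast_zsmul]
  have hΦ : AbelianVariety.prodLift (AbelianVariety.fst A B ≫ φ) (AbelianVariety.snd A B ≫ ψ) ≫
      AbelianVariety.prodLift (AbelianVariety.fst A B ≫ φ) (AbelianVariety.snd A B ≫ ψ) =
      -((p : ℤ) • 𝟙 (A.prod B)) := by
    rw [prodLift_comp_self_eq_neg_nsmul hφ' hψ', natCast_zsmul]
  -- the zero class: constant family
  by_cases h0 : c = 0
  · subst h0
    exact owf_anchored_zero p k (A.prod B) _ hX hΦ ⟨hH.choose⟩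
  -- typing upgrade, then the Weil family with its flat, fibrewise Hodge, Weil section
  have hcW := stub_upgrade p hp hp4 hp7 k (A.prod B) _ hX hΦ hW
  obtain ⟨𝒳, S, f, s₁, s₀, e, σ, hfam, hι, hirr, hsm, hSqp, hfib, hσ, hpt, hHσ, hs₁, Y, Ψ, e₀, x,
    ⟨A₁, f₁, g₁, m, hA₁, hY, hΨ, hm, hfg, hf, hg⟩, hs₀, hx⟩ :=
    hWF p hp hp4 hp7 k hk1 (A.prod B) _ hX hΦ c hcW h0 hrat hH
  -- the global class of the section (W-engine)
  obtain ⟨W, hWσ⟩ := hG f (2 * k) (2 * k) hfam hι hsm hSqp hirr σ hσ hpt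
  have hcls : ∀ (s : ComplexPoints S) (y : complexBetti (fiberOver f s) (2 * k)),
      σ s = ⟨s, y⟩ → complexBetti.map (fiberι f s) (2 * k) W = y := by
    intro s y hy
    have h := (hWσ s).symm.trans hy
    simp only [globalSection, FiberClass.mk.injEq, heq_eq_eq, true_and] at h
    exact h
  have hW₁ : complexBetti.map (fiberι f s₁) (2 * k) W = complexBetti.map e.inv (2 * k) c :=
    hcls s₁ _ hs₁
  have hW₀ : complexBetti.map (fiberι f s₀) (2 * k) W = x := hcls s₀ x hs₀
  -- rationality along the section (proved), Hodge type from the family's clause (a)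
  have hrat₁ : IsRationalClass (σ s₁).cls := by
    rw [hs₁]; exact hrat.map _
  have hratσ : ∀ s, IsRationalClass (σ s).cls :=
    stub_rationalAlongSection f (2 * k) (2 * k) hfam hsm hSqp hirr σ hσ hpt s₁ hrat₁
  have hfibre : ∀ s : ComplexPoints S, IsRationalClass (complexBetti.map (fiberι f s) (2 * k) W) ∧
      IsOfHodgeType (2 * k) (fiberOver f s) (2 * k) k k (complexBetti.map (fiberι f s) (2 * k) W) := by
    intro s
    have h₁ := hratσ s
    have h₂ := hHσ s
    rw [hWσ s] at h₁ h₂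
    exact ⟨h₁, h₂⟩
  -- assemble the anchoring
  refine ⟨𝒳, S, f, s₁, s₀, e, W, hfam, hirr, hsm, hfibre, hfib, ?_, ?_⟩
  · rw [hW₁, ← CategoryTheory.comp_apply, ← complexBetti.map_comp, Iso.hom_inv_id, complexBetti.map_id]
    rfl
  · rw [hW₀]
    exact owf_isoTransport _ Y e₀ k x
      (owf_anchorAlgebraic hp hp4 hp7 A₁ f₁ g₁ m hA₁ hY hΨ hm hfg hf hg hx)

end Summit.HodgeConjecture.HodgeConjecture.Theorems.HeckePrymWeilLine

end
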